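import Summits.Ventures.PercRepro.C041PortProblemCaseIVA

/-!
# The port problem of THEOREM R: CASE (iv), two gates of the same pure type (p6, gen 23)

Setting of `C041PortProblemCaseIVA` (mine-3, C-041.md §3 (iv) / §6 (c)).  Two distinct gates of type `{1}` (or of
type `{2}`): every colouring that opens one of them has weight `≥ 1` (the red gate edge gives the opposite side by the
KEY FACT, a pure-type gate being never deleted on the side it does not carry), the closed colouring has weight `≥ −2`
and injects into each of the three open ones by reddening, so `Φ ≥ #RR + #RB + #BR − 2·#BB ≥ 0`
(`phi_nonneg_of_pure_gates_same₁` / `_same₂`, for any validity predicate kept by reddening; the `Φ∨` / `Φ∧`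
instances).  With cases (ii), (iii) and the mixed case of (iv) this leaves exactly the paper's case (v) — a UNIQUE gate,
switchable, of pure type — for the LEMMA `0 ≤ Φ P` (proofs/P6-THEOREM-R-LEAN-PLAN.md).
-/

namespace PercRepro

namespace PortProblem

namespace Problem

open Finset

variable {V : Type*} {P : Problem V}

section Sums

variable [Fintype V] [DecidableEq V]

open Classical in
/-- **CASE (iv), two gates of type `{1}`**: `0 ≤ Φ`; the closed colouring injects into the three open ones. -/
theorem phi_nonneg_of_pure_gates_same₁ (val : (P.Term → Bool) → Prop)
    (hval : ∀ x e, val x → val (Function.update x e true))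
    {e₁ e₁' : P.Term} (hp₁ : P.IsGate e₁.1.1) (hp₁' : P.IsGate e₁'.1.1)
    (he₁ : e₁.1.2 = false) (he₁' : e₁'.1.2 = false) (hne : e₁ ≠ e₁')
    (hk₁ : P.k₂ e₁.1.1 = false) (hk₁' : P.k₂ e₁'.1.1 = false) :
    0 ≤ ∑ x : P.Term → Bool, if P.Adm x ∧ val x then P.weight x else 0 := by
  rw [sum_split_four val e₁ e₁']
  set RR := univ.filter fun x : P.Term → Bool => (P.Adm x ∧ val x) ∧ x e₁ = true ∧ x e₁' = true with hRR
  set RB := univ.filter fun x : P.Term → Bool => (P.Adm x ∧ val x) ∧ x e₁ = true ∧ x e₁' = false with hRB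
  set BR := univ.filter fun x : P.Term → Bool => (P.Adm x ∧ val x) ∧ x e₁ = false ∧ x e₁' = true with hBR
  set BB := univ.filter fun x : P.Term → Bool => (P.Adm x ∧ val x) ∧ x e₁ = false ∧ x e₁' = false with hBB
  have hRRw : 1 * (RR.card : ℤ) ≤ ∑ x ∈ RR, P.weight x := by
    apply card_mul_le_sum_of_forall
    intro x hx
    rw [hRR, mem_filter] at hx
    exact one_le_weight_of_good (Or.inr (good₂_of_red_pure_gate hp₁ he₁ hk₁ hx.2.2.1))
  have hRBw : 1 * (RB.card : ℤ) ≤ ∑ x ∈ RB, P.weight x := by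
    apply card_mul_le_sum_of_forall
    intro x hx
    rw [hRB, mem_filter] at hx
    exact one_le_weight_of_good (Or.inr (good₂_of_red_pure_gate hp₁ he₁ hk₁ hx.2.2.1))
  have hBRw : 1 * (BR.card : ℤ) ≤ ∑ x ∈ BR, P.weight x := by
    apply card_mul_le_sum_of_forall
    intro x hx
    rw [hBR, mem_filter] at hx
    exact one_le_weight_of_good (Or.inr (good₂_of_red_pure_gate hp₁' he₁' hk₁' hx.2.2.2))
  have hBBw : -2 * (BB.card : ℤ) ≤ ∑ x ∈ BB, P.weight x :=
    card_mul_le_sum_of_forall fun x _ => neg_two_le_weight x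
  -- the three injections of the closed colouring
  have hBB_RR : BB.card ≤ RR.card := by
    refine card_le_card_of_injOn
      (fun x => Function.update (Function.update x e₁ true) e₁' true) ?_ ?_
    · intro x hx
      rw [hBB, coe_filter] at hx
      rw [hRR, coe_filter]
      refine ⟨mem_univ _, ⟨adm_update_true (adm_update_true hx.2.1.1 e₁) e₁',
        hval _ e₁' (hval x e₁ hx.2.1.2)⟩, ?_, ?_⟩
      · show Function.update (Function.update x e₁ true) e₁' true e₁ = true
        rw [Function.update_of_ne hne]
        exact Function.update_self ..
      · show Function.update (Function.update x e₁ true) e₁' true e₁' = true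
        exact Function.update_self ..
    · intro x hx y hy hxy
      rw [hBB, coe_filter] at hx hy
      exact update2_injOn e₁ e₁' false false ⟨hx.2.2.1, hx.2.2.2⟩ ⟨hy.2.2.1, hy.2.2.2⟩ hxy
  have hBB_RB : BB.card ≤ RB.card := by
    refine card_le_card_of_injOn (fun x => Function.update x e₁ true) ?_ ?_
    · intro x hx
      rw [hBB, coe_filter] at hx
      rw [hRB, coe_filter]
      refine ⟨mem_univ _, ⟨adm_update_true hx.2.1.1 e₁, hval x e₁ hx.2.1.2⟩, ?_, ?_⟩
      · show Function.update x e₁ true e₁ = true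
        exact Function.update_self ..
      · show Function.update x e₁ true e₁' = false
        rw [Function.update_of_ne hne.symm]
        exact hx.2.2.2
    · intro x hx y hy hxy
      rw [hBB, coe_filter] at hx hy
      exact update_injOn e₁ true false hx.2.2.1 hy.2.2.1 hxy
  have hBB_BR : BB.card ≤ BR.card := by
    refine card_le_card_of_injOn (fun x => Function.update x e₁' true) ?_ ?_
    · intro x hx
      rw [hBB, coe_filter] at hx
      rw [hBR, coe_filter]
      refine ⟨mem_univ _, ⟨adm_update_true hx.2.1.1 e₁', hval x e₁' hx.2.1.2⟩, ?_, ?_⟩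
      · show Function.update x e₁' true e₁ = false
        rw [Function.update_of_ne hne]
        exact hx.2.2.1
      · show Function.update x e₁' true e₁' = true
        exact Function.update_self ..
    · intro x hx y hy hxy
      rw [hBB, coe_filter] at hx hy
      exact update_injOn e₁' true false hx.2.2.2 hy.2.2.2 hxy
  have h1 : (BB.card : ℤ) ≤ RR.card := by exact_mod_cast hBB_RR
  have h2 : (BB.card : ℤ) ≤ RB.card := by exact_mod_cast hBB_RB
  have h3 : (BB.card : ℤ) ≤ BR.card := by exact_mod_cast hBB_BR
  linarith

open Classical in
/-- **CASE (iv), two gates of type `{2}`**: `0 ≤ Φ`. -/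
theorem phi_nonneg_of_pure_gates_same₂ (val : (P.Term → Bool) → Prop)
    (hval : ∀ x e, val x → val (Function.update x e true))
    {e₂ e₂' : P.Term} (hp₂ : P.IsGate e₂.1.1) (hp₂' : P.IsGate e₂'.1.1)
    (he₂ : e₂.1.2 = true) (he₂' : e₂'.1.2 = true) (hne : e₂ ≠ e₂')
    (hk₂ : P.k₁ e₂.1.1 = false) (hk₂' : P.k₁ e₂'.1.1 = false) :
    0 ≤ ∑ x : P.Term → Bool, if P.Adm x ∧ val x then P.weight x else 0 := by
  rw [sum_split_four val e₂ e₂']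
  set RR := univ.filter fun x : P.Term → Bool => (P.Adm x ∧ val x) ∧ x e₂ = true ∧ x e₂' = true with hRR
  set RB := univ.filter fun x : P.Term → Bool => (P.Adm x ∧ val x) ∧ x e₂ = true ∧ x e₂' = false with hRB
  set BR := univ.filter fun x : P.Term → Bool => (P.Adm x ∧ val x) ∧ x e₂ = false ∧ x e₂' = true with hBR
  set BB := univ.filter fun x : P.Term → Bool => (P.Adm x ∧ val x) ∧ x e₂ = false ∧ x e₂' = false with hBB
  have hRRw : 1 * (RR.card : ℤ) ≤ ∑ x ∈ RR, P.weight x := by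
    apply card_mul_le_sum_of_forall
    intro x hx
    rw [hRR, mem_filter] at hx
    exact one_le_weight_of_good (Or.inl (good₁_of_red_pure_gate hp₂ he₂ hk₂ hx.2.2.1))
  have hRBw : 1 * (RB.card : ℤ) ≤ ∑ x ∈ RB, P.weight x := by
    apply card_mul_le_sum_of_forall
    intro x hx
    rw [hRB, mem_filter] at hx
    exact one_le_weight_of_good (Or.inl (good₁_of_red_pure_gate hp₂ he₂ hk₂ hx.2.2.1))
  have hBRw : 1 * (BR.card : ℤ) ≤ ∑ x ∈ BR, P.weight x := by
    apply card_mul_le_sum_of_forall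
    intro x hx
    rw [hBR, mem_filter] at hx
    exact one_le_weight_of_good (Or.inl (good₁_of_red_pure_gate hp₂' he₂' hk₂' hx.2.2.2))
  have hBBw : -2 * (BB.card : ℤ) ≤ ∑ x ∈ BB, P.weight x :=
    card_mul_le_sum_of_forall fun x _ => neg_two_le_weight x
  have hBB_RR : BB.card ≤ RR.card := by
    refine card_le_card_of_injOn
      (fun x => Function.update (Function.update x e₂ true) e₂' true) ?_ ?_
    · intro x hx
      rw [hBB, coe_filter] at hx
      rw [hRR, coe_filter]
      refine ⟨mem_univ _, ⟨adm_update_true (adm_update_true hx.2.1.1 e₂) e₂',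
        hval _ e₂' (hval x e₂ hx.2.1.2)⟩, ?_, ?_⟩
      · show Function.update (Function.update x e₂ true) e₂' true e₂ = true
        rw [Function.update_of_ne hne]
        exact Function.update_self ..
      · show Function.update (Function.update x e₂ true) e₂' true e₂' = true
        exact Function.update_self ..
    · intro x hx y hy hxy
      rw [hBB, coe_filter] at hx hy
      exact update2_injOn e₂ e₂' false false ⟨hx.2.2.1, hx.2.2.2⟩ ⟨hy.2.2.1, hy.2.2.2⟩ hxy
  have hBB_RB : BB.card ≤ RB.card := by
    refine card_le_card_of_injOn (fun x => Function.update x e₂ true) ?_ ?_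
    · intro x hx
      rw [hBB, coe_filter] at hx
      rw [hRB, coe_filter]
      refine ⟨mem_univ _, ⟨adm_update_true hx.2.1.1 e₂, hval x e₂ hx.2.1.2⟩, ?_, ?_⟩
      · show Function.update x e₂ true e₂ = true
        exact Function.update_self ..
      · show Function.update x e₂ true e₂' = false
        rw [Function.update_of_ne hne.symm]
        exact hx.2.2.2
    · intro x hx y hy hxy
      rw [hBB, coe_filter] at hx hy
      exact update_injOn e₂ true false hx.2.2.1 hy.2.2.1 hxy
  have hBB_BR : BB.card ≤ BR.card := by
    refine card_le_card_of_injOn (fun x => Function.update x e₂' true) ?_ ?_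
    · intro x hx
      rw [hBB, coe_filter] at hx
      rw [hBR, coe_filter]
      refine ⟨mem_univ _, ⟨adm_update_true hx.2.1.1 e₂', hval x e₂' hx.2.1.2⟩, ?_, ?_⟩
      · show Function.update x e₂' true e₂ = false
        rw [Function.update_of_ne hne]
        exact hx.2.2.1
      · show Function.update x e₂' true e₂' = true
        exact Function.update_self ..
    · intro x hx y hy hxy
      rw [hBB, coe_filter] at hx hy
      exact update_injOn e₂' true false hx.2.2.2 hy.2.2.2 hxy
  have h1 : (BB.card : ℤ) ≤ RR.card := by exact_mod_cast hBB_RR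
  have h2 : (BB.card : ℤ) ≤ RB.card := by exact_mod_cast hBB_RB
  have h3 : (BB.card : ℤ) ≤ BR.card := by exact_mod_cast hBB_BR
  linarith

open Classical in
/-- **CASE (iv), `Φ∨`, two distinct gates of type `{1}`.** -/
theorem phiOr_nonneg_of_pure_gates_same₁ {g₁ g₁' : V} (hp₁ : P.IsGate g₁) (hp₁' : P.IsGate g₁')
    (hne : g₁ ≠ g₁') (hk₁ : P.k₁ g₁ = true) (hk₁' : P.k₁ g₁' = true)
    (hk₂ : P.k₂ g₁ = false) (hk₂' : P.k₂ g₁' = false) : 0 ≤ P.phiOr := by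
  let e₁ : P.Term := ⟨(g₁, false), hp₁.mem, fun _ => hk₁, fun h => Bool.noConfusion h⟩
  let e₁' : P.Term := ⟨(g₁', false), hp₁'.mem, fun _ => hk₁', fun h => Bool.noConfusion h⟩
  have hne' : e₁ ≠ e₁' := fun h => hne (congrArg (fun e : P.Term => e.1.1) h)
  unfold phiOr
  convert phi_nonneg_of_pure_gates_same₁ (fun x => P.X₁ x ∨ P.X₂ x) valOr_update
    (e₁ := e₁) (e₁' := e₁') hp₁ hp₁' rfl rfl hne' hk₂ hk₂' using 3

open Classical in
/-- **CASE (iv), `Φ∧`, two distinct gates of type `{1}`.** -/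
theorem phiAnd_nonneg_of_pure_gates_same₁ {g₁ g₁' : V} (hp₁ : P.IsGate g₁) (hp₁' : P.IsGate g₁')
    (hne : g₁ ≠ g₁') (hk₁ : P.k₁ g₁ = true) (hk₁' : P.k₁ g₁' = true)
    (hk₂ : P.k₂ g₁ = false) (hk₂' : P.k₂ g₁' = false) : 0 ≤ P.phiAnd := by
  let e₁ : P.Term := ⟨(g₁, false), hp₁.mem, fun _ => hk₁, fun h => Bool.noConfusion h⟩
  let e₁' : P.Term := ⟨(g₁', false), hp₁'.mem, fun _ => hk₁', fun h => Bool.noConfusion h⟩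
  have hne' : e₁ ≠ e₁' := fun h => hne (congrArg (fun e : P.Term => e.1.1) h)
  unfold phiAnd
  convert phi_nonneg_of_pure_gates_same₁ (fun x => P.X₁ x ∧ P.X₂ x) valAnd_update
    (e₁ := e₁) (e₁' := e₁') hp₁ hp₁' rfl rfl hne' hk₂ hk₂' using 3

open Classical in
/-- **CASE (iv), `Φ∨`, two distinct gates of type `{2}`.** -/
theorem phiOr_nonneg_of_pure_gates_same₂ {g₂ g₂' : V} (hp₂ : P.IsGate g₂) (hp₂' : P.IsGate g₂')
    (hne : g₂ ≠ g₂') (hk₂ : P.k₂ g₂ = true) (hk₂' : P.k₂ g₂' = true)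
    (hk₁ : P.k₁ g₂ = false) (hk₁' : P.k₁ g₂' = false) : 0 ≤ P.phiOr := by
  let e₂ : P.Term := ⟨(g₂, true), hp₂.mem, fun h => Bool.noConfusion h, fun _ => hk₂⟩
  let e₂' : P.Term := ⟨(g₂', true), hp₂'.mem, fun h => Bool.noConfusion h, fun _ => hk₂'⟩
  have hne' : e₂ ≠ e₂' := fun h => hne (congrArg (fun e : P.Term => e.1.1) h)
  unfold phiOr
  convert phi_nonneg_of_pure_gates_same₂ (fun x => P.X₁ x ∨ P.X₂ x) valOr_update
    (e₂ := e₂) (e₂' := e₂') hp₂ hp₂' rfl rfl hne' hk₁ hk₁' using 3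

open Classical in
/-- **CASE (iv), `Φ∧`, two distinct gates of type `{2}`.** -/
theorem phiAnd_nonneg_of_pure_gates_same₂ {g₂ g₂' : V} (hp₂ : P.IsGate g₂) (hp₂' : P.IsGate g₂')
    (hne : g₂ ≠ g₂') (hk₂ : P.k₂ g₂ = true) (hk₂' : P.k₂ g₂' = true)
    (hk₁ : P.k₁ g₂ = false) (hk₁' : P.k₁ g₂' = false) : 0 ≤ P.phiAnd := by
  let e₂ : P.Term := ⟨(g₂, true), hp₂.mem, fun h => Bool.noConfusion h, fun _ => hk₂⟩
  let e₂' : P.Term := ⟨(g₂', true), hp₂'.mem, fun h => Bool.noConfusion h, fun _ => hk₂'⟩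
  have hne' : e₂ ≠ e₂' := fun h => hne (congrArg (fun e : P.Term => e.1.1) h)
  unfold phiAnd
  convert phi_nonneg_of_pure_gates_same₂ (fun x => P.X₁ x ∧ P.X₂ x) valAnd_update
    (e₂ := e₂) (e₂' := e₂') hp₂ hp₂' rfl rfl hne' hk₁ hk₁' using 3

end Sums

end Problem

end PortProblem

end PercRepro
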